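import Summits.KontsevichZagierPeriods.KontsevichZagierPeriods.Theorems.TerasomaMultiplicationMultiplicationAccessibleStubMultiplicativityGlueAux

/-!
# `MultiplicationAccessible` (stmt-KontsevichZagierPeriods-12305), line `shifted-family-prime-sieve`,
stub `stub_multiplicativityGlue` — helper API, part 2: products of Beta boxes and local moves

Continuing part 1 (Beta boxes `[(0,1)^N, κ ∏ᵢ zᵢ^(αᵢ−1)(1−zᵢ)^(βᵢ−1)]`, written out in full):

* `equiv_prod` / `beta_prod_eq` — products of equivalent boxes are equivalent
  (`KZ.Equivalent.prod`), and the product of two Beta boxes is the concatenated Beta box;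
* `local_move` — the workhorse: an equivalence of `N₁`-dimensional Beta boxes may be applied on any
  `N₁` coordinates `ι : Fin N₁ ↪ Fin N` of an `N`-dimensional Beta box, the other exponents being
  unchanged and the constants multiplying;
* `beta_congr` — pointwise-equal data give equivalent boxes.
-/

noncomputable section

open MeasureTheory Set Real
open scoped BigOperators

namespace Summit.KontsevichZagierPeriods.TerasomaMultiplication.MultiplicationAccessible.MultGlue

open Literature.NumberTheory.Transcendental
open Literature.NumberTheory.Transcendental.KZ
open Summit.KontsevichZagierPeriods.MultiplicationAccessible.Negative (boxDom)

/-! ## Products -/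

/-- The product of box representatives of `F₁` and `F₂` is a box representative of
`F₁ ⊗ F₂` (`KZ.IntegralRep.prod_integrand_eq`). [cite: KontsevichZagier2001, §4.1] -/
theorem isRep_prod {N₁ N₂ : ℕ} {F₁ : (Fin N₁ → ℝ) → ℝ} {F₂ : (Fin N₂ → ℝ) → ℝ}
    {G : (Fin (N₁ + N₂) → ℝ) → ℝ} {r₁ : KZ.IntegralRep N₁} {r₂ : KZ.IntegralRep N₂}
    (hr₁ : r₁.domain = boxDom N₁ ∧ Set.EqOn r₁.integrand F₁ r₁.domain)
    (hr₂ : r₂.domain = boxDom N₂ ∧ Set.EqOn r₂.integrand F₂ r₂.domain)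
    (hG : ∀ z ∈ boxDom (N₁ + N₂),
      G z = F₁ (fun i => z (Fin.castAdd N₂ i)) * F₂ (fun j => z (Fin.natAdd N₁ j))) :
    (r₁.prod r₂).domain = boxDom (N₁ + N₂) ∧
      Set.EqOn (r₁.prod r₂).integrand G (r₁.prod r₂).domain := by
  have hdom : (r₁.prod r₂).domain = boxDom (N₁ + N₂) := by
    ext z
    simp only [IntegralRep.prod_domain, IntegralRep.mem_prodDomain, hr₁.1, hr₂.1, boxDom,
      mem_setOf_eq]
    constructor
    · rintro ⟨h1, h2⟩ k
      exact Fin.addCases (motive := fun k => z k ∈ Ioo (0:ℝ) 1) (fun i => h1 i) (fun j => h2 j) k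
    · intro h
      exact ⟨fun i => h _, fun j => h _⟩
  refine ⟨hdom, fun z hz => ?_⟩
  have hzb : z ∈ boxDom (N₁ + N₂) := hdom ▸ hz
  have hz1 : (fun i => z (Fin.castAdd N₂ i)) ∈ r₁.domain :=
    ((IntegralRep.mem_prodDomain r₁ r₂ z).mp hz).1
  have hz2 : (fun j => z (Fin.natAdd N₁ j)) ∈ r₂.domain :=
    ((IntegralRep.mem_prodDomain r₁ r₂ z).mp hz).2
  rw [IntegralRep.prod_integrand_eq, IntegralRep.prodFun_apply, hr₁.2 hz1, hr₂.2 hz2, hG z hzb]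

/-- **Product move**: `F₁ ∼ F₁'` and `F₂ ∼ F₂'` give `F₁ ⊗ F₂ ∼ F₁' ⊗ F₂'`
(`KZ.Equivalent.prod`). [cite: KontsevichZagier2001, §4.1] -/
theorem equiv_prod {N₁ N₁' N₂ N₂' : ℕ} {F₁ : (Fin N₁ → ℝ) → ℝ} {F₁' : (Fin N₁' → ℝ) → ℝ}
    {F₂ : (Fin N₂ → ℝ) → ℝ} {F₂' : (Fin N₂' → ℝ) → ℝ}
    {G : (Fin (N₁ + N₂) → ℝ) → ℝ} {G' : (Fin (N₁' + N₂') → ℝ) → ℝ}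
    (h₁ : (∃ (ρ₁ : KZ.IntegralRep _) (ρ₂ : KZ.IntegralRep _),
        (ρ₁.domain = boxDom _ ∧ EqOn ρ₁.integrand F₁ ρ₁.domain) ∧
        (ρ₂.domain = boxDom _ ∧ EqOn ρ₂.integrand F₁' ρ₂.domain) ∧
        KZ.Equivalent ρ₁ ρ₂))
    (h₂ : (∃ (ρ₁ : KZ.IntegralRep _) (ρ₂ : KZ.IntegralRep _),
        (ρ₁.domain = boxDom _ ∧ EqOn ρ₁.integrand F₂ ρ₁.domain) ∧
        (ρ₂.domain = boxDom _ ∧ EqOn ρ₂.integrand F₂' ρ₂.domain) ∧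
        KZ.Equivalent ρ₁ ρ₂))
    (hG : ∀ z ∈ boxDom (N₁ + N₂),
      G z = F₁ (fun i => z (Fin.castAdd N₂ i)) * F₂ (fun j => z (Fin.natAdd N₁ j)))
    (hG' : ∀ z ∈ boxDom (N₁' + N₂'),
      G' z = F₁' (fun i => z (Fin.castAdd N₂' i)) * F₂' (fun j => z (Fin.natAdd N₁' j))) :
    (∃ (ρ₁ : KZ.IntegralRep _) (ρ₂ : KZ.IntegralRep _),
        (ρ₁.domain = boxDom _ ∧ EqOn ρ₁.integrand G ρ₁.domain) ∧
        (ρ₂.domain = boxDom _ ∧ EqOn ρ₂.integrand G' ρ₂.domain) ∧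
        KZ.Equivalent ρ₁ ρ₂) := by
  obtain ⟨r₁, r₁', hr₁, hr₁', e₁⟩ := h₁
  obtain ⟨r₂, r₂', hr₂, hr₂', e₂⟩ := h₂
  exact ⟨r₁.prod r₂, r₁'.prod r₂', isRep_prod hr₁ hr₂ hG, isRep_prod hr₁' hr₂' hG', e₁.prod e₂⟩

/-- The product of two Beta boxes is the Beta box of the concatenated exponent vectors, the
constants multiplying (`Fin.prod_univ_add`). [folklore] -/
theorem beta_prod_eq {N₁ N₂ : ℕ} (κ₁ κ₂ κ : ℝ) (hκ : κ = κ₁ * κ₂) (α₁ β₁ : Fin N₁ → ℚ)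
    (α₂ β₂ : Fin N₂ → ℚ) (α β : Fin (N₁ + N₂) → ℚ)
    (hα₁ : ∀ i, α (Fin.castAdd N₂ i) = α₁ i) (hα₂ : ∀ j, α (Fin.natAdd N₁ j) = α₂ j)
    (hβ₁ : ∀ i, β (Fin.castAdd N₂ i) = β₁ i) (hβ₂ : ∀ j, β (Fin.natAdd N₁ j) = β₂ j)
    (z : Fin (N₁ + N₂) → ℝ) :
    (fun z : Fin _ → ℝ => κ *
        ∏ i, (z i ^ (((α i : ℚ) : ℝ) - 1) * (1 - z i) ^ (((β i : ℚ) : ℝ) - 1))) z =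
      (fun z : Fin _ → ℝ => κ₁ * ∏ i,
          (z i ^ (((α₁ i : ℚ) : ℝ) - 1) *
            (1 - z i) ^ (((β₁ i : ℚ) : ℝ) - 1))) (fun i => z (Fin.castAdd N₂ i)) *
        (fun z : Fin _ → ℝ => κ₂ * ∏ i,
            (z i ^ (((α₂ i : ℚ) : ℝ) - 1) *
              (1 - z i) ^ (((β₂ i : ℚ) : ℝ) - 1))) (fun j => z (Fin.natAdd N₁ j)) := by
  simp only []
  rw [Fin.prod_univ_add]
  simp only [hα₁, hα₂, hβ₁, hβ₂, hκ]
  ring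

/-! ## Local moves -/

/-- Every injection `ι : Fin N₁ ↪ Fin N` extends to a bijection `Fin (N₁ + M) ≃ Fin N` whose
first `N₁` values are `ι`. [folklore] -/
theorem exists_extend {N₁ N : ℕ} (ι : Fin N₁ → Fin N) (hι : Function.Injective ι) :
    ∃ (M : ℕ) (e : Fin (N₁ + M) ≃ Fin N), ∀ i, e (Fin.castAdd M i) = ι i := by
  classical
  refine ⟨Fintype.card ((Set.range ι)ᶜ : Set (Fin N)),
    finSumFinEquiv.symm.trans (((Equiv.ofInjective ι hι).sumCongr
      (Fintype.equivFin ((Set.range ι)ᶜ : Set (Fin N))).symm).trans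
        (Equiv.Set.sumCompl (Set.range ι))), fun i => ?_⟩
  simp [Equiv.Set.sumCompl_apply_inl]

/-- **The local move.** Let `ι : Fin N₁ ↪ Fin N` select `N₁` coordinates of an `N`-dimensional
Beta box `[κ₁κ, α, β]`, on which its exponents are `(α₁, β₁)`. If the `N₁`-dimensional Beta boxes
`[κ₁, α₁, β₁] ∼ [κ₁', α₁', β₁']` are equivalent, then so are `[κ₁κ, α, β] ∼ [κ₁'κ, α', β']` for the
exponent vectors `α', β'` obtained by replacing `(α₁, β₁)` by `(α₁', β₁')` on the selected
coordinates: reindex to put the selected coordinates first, split off the product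
(`beta_prod_eq`), apply `KZ.Equivalent.prod`, and reindex back. [cite: KontsevichZagier2001, §1.2] -/
theorem local_move {N₁ N : ℕ} (ι : Fin N₁ → Fin N) (hι : Function.Injective ι)
    {κ₁ κ₁' κ κ₀ κ₀' : ℝ} (hκ₁ : IsAlgebraic ℚ κ₁) (hκ₁' : IsAlgebraic ℚ κ₁')
    (hκ : IsAlgebraic ℚ κ) (h0 : κ₀ = κ₁ * κ) (h0' : κ₀' = κ₁' * κ)
    {α₁ β₁ α₁' β₁' : Fin N₁ → ℚ} {α β α' β' : Fin N → ℚ}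
    (hα : ∀ k, 0 < α k) (hβ : ∀ k, 0 < β k) (hα' : ∀ k, 0 < α' k) (hβ' : ∀ k, 0 < β' k)
    (hmove : (∃ (ρ₁ : KZ.IntegralRep _) (ρ₂ : KZ.IntegralRep _),
        (ρ₁.domain = boxDom _ ∧ EqOn ρ₁.integrand
          (fun z : Fin _ → ℝ => κ₁ *
              ∏ i, (z i ^ (((α₁ i : ℚ) : ℝ) - 1) * (1 - z i) ^ (((β₁ i : ℚ) : ℝ) - 1)))
          ρ₁.domain) ∧
        (ρ₂.domain = boxDom _ ∧ EqOn ρ₂.integrand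
          (fun z : Fin _ → ℝ => κ₁' *
              ∏ i, (z i ^ (((α₁' i : ℚ) : ℝ) - 1) * (1 - z i) ^ (((β₁' i : ℚ) : ℝ) - 1)))
          ρ₂.domain) ∧
        KZ.Equivalent ρ₁ ρ₂))
    (h1 : ∀ i, α (ι i) = α₁ i) (h2 : ∀ i, β (ι i) = β₁ i)
    (h3 : ∀ i, α' (ι i) = α₁' i) (h4 : ∀ i, β' (ι i) = β₁' i)
    (h5 : ∀ k, k ∉ Set.range ι → α' k = α k) (h6 : ∀ k, k ∉ Set.range ι → β' k = β k) :
    (∃ (ρ₁ : KZ.IntegralRep _) (ρ₂ : KZ.IntegralRep _),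
        (ρ₁.domain = boxDom _ ∧ EqOn ρ₁.integrand
          (fun z : Fin _ → ℝ => κ₀ *
              ∏ i, (z i ^ (((α i : ℚ) : ℝ) - 1) * (1 - z i) ^ (((β i : ℚ) : ℝ) - 1)))
          ρ₁.domain) ∧
        (ρ₂.domain = boxDom _ ∧ EqOn ρ₂.integrand
          (fun z : Fin _ → ℝ => κ₀' *
              ∏ i, (z i ^ (((α' i : ℚ) : ℝ) - 1) * (1 - z i) ^ (((β' i : ℚ) : ℝ) - 1)))
          ρ₂.domain) ∧
        KZ.Equivalent ρ₁ ρ₂) := by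
  obtain ⟨M, e, he⟩ := exists_extend ι hι
  have hne : ∀ j : Fin M, e (Fin.natAdd N₁ j) ∉ Set.range ι := by
    rintro j ⟨i, hi⟩
    rw [← he] at hi
    have h := congrArg Fin.val (e.injective hi)
    simp only [Fin.val_castAdd, Fin.val_natAdd] at h
    have := i.isLt
    omega
  have hκ₀ : IsAlgebraic ℚ κ₀ := h0 ▸ hκ₁.mul hκ
  have hκ₀' : IsAlgebraic ℚ κ₀' := h0' ▸ hκ₁'.mul hκ
  -- (a) put the selected coordinates first
  have hA := beta_perm e.symm hκ₀ (α := α) (β := β) (α' := fun k => α (e k))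
    (β' := fun k => β (e k)) hα hβ (fun i => by simp) (fun i => by simp)
  -- (b) the product move on the first block (the second block does not move)
  have hrest := equiv_of_eqOn
    (G := (fun z : Fin _ → ℝ => κ * ∏ i,
        (z i ^ ((((fun j => α (e (Fin.natAdd N₁ j))) i : ℚ) : ℝ) - 1) *
          (1 - z i) ^ ((((fun j => β (e (Fin.natAdd N₁ j))) i : ℚ) : ℝ) - 1))))
    (exists_betaRep κ hκ (fun j => α (e (Fin.natAdd N₁ j))) (fun j => β (e (Fin.natAdd N₁ j)))
      (fun j => hα _) (fun j => hβ _)) (fun z _ => rfl)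
  have hB := equiv_prod hmove hrest
    (G := (fun z : Fin _ → ℝ => κ₀ * ∏ i,
        (z i ^ ((((fun k => α (e k)) i : ℚ) : ℝ) - 1) *
          (1 - z i) ^ ((((fun k => β (e k)) i : ℚ) : ℝ) - 1))))
    (G' := (fun z : Fin _ → ℝ => κ₀' * ∏ i,
        (z i ^ ((((fun k => α' (e k)) i : ℚ) : ℝ) - 1) *
          (1 - z i) ^ ((((fun k => β' (e k)) i : ℚ) : ℝ) - 1))))
    (fun z _ => beta_prod_eq κ₁ κ κ₀ h0 α₁ β₁
      (fun j => α (e (Fin.natAdd N₁ j))) (fun j => β (e (Fin.natAdd N₁ j)))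
      (fun k => α (e k)) (fun k => β (e k))
      (fun i => by simp only [he, h1]) (fun j => rfl) (fun i => by simp only [he, h2])
      (fun j => rfl) z)
    (fun z _ => beta_prod_eq κ₁' κ κ₀' h0' α₁' β₁'
      (fun j => α (e (Fin.natAdd N₁ j))) (fun j => β (e (Fin.natAdd N₁ j)))
      (fun k => α' (e k)) (fun k => β' (e k))
      (fun i => by simp only [he, h3]) (fun j => by simp only [h5 _ (hne j)])
      (fun i => by simp only [he, h4]) (fun j => by simp only [h6 _ (hne j)]) z)
  -- (c) back to the original order
  have hC := beta_perm e hκ₀' (α := fun k => α' (e k)) (β := fun k => β' (e k)) (α' := α')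
    (β' := β') (fun k => hα' _) (fun k => hβ' _) (fun k => rfl) (fun k => rfl)
  exact equiv_trans hA (equiv_trans hB hC)

/-- Pointwise-equal exponent vectors and equal constants give equivalent Beta boxes. [folklore] -/
theorem beta_congr {N : ℕ} {κ κ' : ℝ} (hκ : IsAlgebraic ℚ κ) (hκκ' : κ = κ')
    {α β α' β' : Fin N → ℚ} (hαp : ∀ i, 0 < α i) (hβp : ∀ i, 0 < β i)
    (hα : ∀ i, α i = α' i) (hβ : ∀ i, β i = β' i) :
    (∃ (ρ₁ : KZ.IntegralRep _) (ρ₂ : KZ.IntegralRep _),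
        (ρ₁.domain = boxDom _ ∧ EqOn ρ₁.integrand
          (fun z : Fin _ → ℝ => κ *
              ∏ i, (z i ^ (((α i : ℚ) : ℝ) - 1) * (1 - z i) ^ (((β i : ℚ) : ℝ) - 1)))
          ρ₁.domain) ∧
        (ρ₂.domain = boxDom _ ∧ EqOn ρ₂.integrand
          (fun z : Fin _ → ℝ => κ' *
              ∏ i, (z i ^ (((α' i : ℚ) : ℝ) - 1) * (1 - z i) ^ (((β' i : ℚ) : ℝ) - 1)))
          ρ₂.domain) ∧
        KZ.Equivalent ρ₁ ρ₂) :=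
  equiv_of_eqOn (exists_betaRep κ hκ α β hαp hβp) fun z _ => by
    simp only [hα, hβ, hκκ']

end Summit.KontsevichZagierPeriods.TerasomaMultiplication.MultiplicationAccessible.MultGlue

namespace Summit.KontsevichZagierPeriods.TerasomaMultiplication.MultiplicationAccessible

open Literature.NumberTheory.Transcendental

/-- **Registered sub-goal `stub_multiplicativityGlue_part2` of stub `stub_multiplicativityGlue`**
(`∀`-form of `MultGlue.local_move`): an equivalence of `N₁`-dimensional Beta boxes may be applied
on any `N₁` coordinates `ι` of an `N`-dimensional Beta box, the other exponents being unchanged and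
the constants multiplying. [cite: KontsevichZagier2001, §1.2] -/
theorem stub_multiplicativityGlue_part2 :
    ∀ (N₁ N : ℕ) (ι : Fin N₁ → Fin N), Function.Injective ι →
      ∀ (κ₁ κ₁' κ κ₀ κ₀' : ℝ), IsAlgebraic ℚ κ₁ → IsAlgebraic ℚ κ₁' → IsAlgebraic ℚ κ →
      κ₀ = κ₁ * κ → κ₀' = κ₁' * κ →
      ∀ (α₁ β₁ α₁' β₁' : Fin N₁ → ℚ) (α β α' β' : Fin N → ℚ),
      (∀ k, 0 < α k) → (∀ k, 0 < β k) → (∀ k, 0 < α' k) → (∀ k, 0 < β' k) →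
      (∃ (ρ₁ : KZ.IntegralRep N₁) (ρ₂ : KZ.IntegralRep N₁),
        (ρ₁.domain = {z | ∀ i, z i ∈ Set.Ioo (0:ℝ) 1} ∧ Set.EqOn ρ₁.integrand (fun z => κ₁ * ∏ i,
          ((z i) ^ (((α₁ i : ℚ) : ℝ) - 1) * (1 - z i) ^ (((β₁ i : ℚ) : ℝ) - 1))) ρ₁.domain) ∧
        (ρ₂.domain = {z | ∀ i, z i ∈ Set.Ioo (0:ℝ) 1} ∧ Set.EqOn ρ₂.integrand (fun z => κ₁' * ∏ i,
          ((z i) ^ (((α₁' i : ℚ) : ℝ) - 1) * (1 - z i) ^ (((β₁' i : ℚ) : ℝ) - 1))) ρ₂.domain) ∧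
        KZ.Equivalent ρ₁ ρ₂) →
      (∀ i, α (ι i) = α₁ i) → (∀ i, β (ι i) = β₁ i) →
      (∀ i, α' (ι i) = α₁' i) → (∀ i, β' (ι i) = β₁' i) →
      (∀ k, k ∉ Set.range ι → α' k = α k) → (∀ k, k ∉ Set.range ι → β' k = β k) →
      ∃ (ρ₁ : KZ.IntegralRep N) (ρ₂ : KZ.IntegralRep N),
        (ρ₁.domain = {z | ∀ i, z i ∈ Set.Ioo (0:ℝ) 1} ∧ Set.EqOn ρ₁.integrand (fun z => κ₀ * ∏ i,
          ((z i) ^ (((α i : ℚ) : ℝ) - 1) * (1 - z i) ^ (((β i : ℚ) : ℝ) - 1))) ρ₁.domain) ∧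
        (ρ₂.domain = {z | ∀ i, z i ∈ Set.Ioo (0:ℝ) 1} ∧ Set.EqOn ρ₂.integrand (fun z => κ₀' * ∏ i,
          ((z i) ^ (((α' i : ℚ) : ℝ) - 1) * (1 - z i) ^ (((β' i : ℚ) : ℝ) - 1))) ρ₂.domain) ∧
        KZ.Equivalent ρ₁ ρ₂ :=
  fun _ _ ι hι _ _ _ _ _ hκ₁ hκ₁' hκ h0 h0' _ _ _ _ _ _ _ _ hα hβ hα' hβ' hmove h1 h2 h3 h4 h5 h6 =>
    MultGlue.local_move ι hι hκ₁ hκ₁' hκ h0 h0' hα hβ hα' hβ' hmove h1 h2 h3 h4 h5 h6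

end Summit.KontsevichZagierPeriods.TerasomaMultiplication.MultiplicationAccessible

end
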